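import Literature.IUT.HodgeTheaters.StableCurveTemperedDataOfSpecialFibreTowerComplete
import Literature.IUT.HodgeTheaters.StableCurveTemperedDataOfSpecialFibreCor25
import HarnessLib

/-!
# [IUTchI] Prop. 2.4 (i)(ii)(iii) and Cor. 2.5 AS TYPED at the genuine 𝔛-datum carrying L3's `PiData`,
# from the per-level printed inputs — (INV) discharged

Mochizuki, *Inter-universal Teichmüller theory I: construction of Hodge theaters*, kurims manuscript (May 2020), §2,
Prop. 2.4 p. 50 and its proof pp. 50–51, Cor. 2.5 p. 51 ([IUTchI] Prop 2.4, Cor 2.5 pp.50-51)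
[claim: Mochizuki2012, status: disputed] (D-0012 claim key; series status DISPUTED — nothing of the series is asserted
here), over Mochizuki, *Semi-graphs of anabelioids*, Publ. RIMS **42** (2006), Ex. 3.10 pp. 44–45
[cite: MochizukiSemiAnbd2006, Ex 3.10 pp.44-45].

PROOF-ONLY capstone (abc-iut cell, block F seat abc-iut-f-193; FACT-LIST rows F-2599 `Prop24i` · F-2600 `Prop24ii` ·
F-2601 `Prop24iii` AT THE NAMED INSTANCE `StableCurveTemperedData.ofSpecialFibre X d S h36 …`; no definitions, no new
`Prop` fact).  With `StableCurveTemperedDataOfSpecialFibreTowerComplete.lean` (p445247: the inverse-limit input (INV)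
of the proof of Prop. 2.4 (i) is a THEOREM from `hadm` + `P.N_cofinal`) the whole Prop. 2.4 / Cor. 2.5 block of the
[IUTchI] §2 held rows at the genuine datum reads, over L3's origin-data record `P : SpecialFibreTower.PiData X d S T`:

* `prop24iii_ofPiData_of_admKer_nhds_one` — Prop. 2.4 (iii) (F-2601) ⇐ `hstf` · `hA3` · `hspec` · `hadm` + verticial/node
  DATA + a cusp `x` (abc-iut-L5-t11's `prop24iii_ofSpecialFibre`: the pro-`Σ` Sylow atom from `I_x ≅ Ẑ(1)`);
* `prop24_ofPiData_of_admKer_nhds_one` — Prop. 2.4 (i) ∧ (ii) ∧ (iii) ⇐ `hstf` · `hA3` · `hspec` · `hadm` · `hLev` + DATA + `x`;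
* `prop24_cor25_ofPiData_of_admKer_nhds_one` — the same ∧ Cor. 2.5 (both clauses, abc-iut-L5-t11's `cor25_ofSpecialFibre`:
  "`D_x` compact", "open image in `G_k`", "`I_x ≅ Ẑ(1)`", "`G_k` compact infinite" are theorems of the §6 interface).

LAW binders of the block: `hstf` ([Config] Rmk 1.2.2) · `hA3` ([AbsTopII] Prop 1.3 (iv) / [NodNon] Lem 1.9 (ii), level
form) · `hspec` (the `p ∉ Σ` specialisation half) · `hadm` (the admissible kernels shrink to `1`) · `hLev` (the arithmetic
Prop. 2.1 per level, [SemiAnbd] Thm 5.4 (ii) / Ex 5.6) — each a primitive printed input or a prerequisite-paper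
statement BY NAME; no node statement of [IUTchI] among the hypotheses; versus CERT-L5 v0.6 (β) (p442476) the binder
`hINV` is GONE.  Typed ≠ discharged for the five laws; `P` is origin data asserted for no curve; nothing here asserts
that abc is proved or refuted, and nothing here bears on [IUTchIII] Cor. 3.12.
-/

noncomputable section

namespace Literature.IUT.HodgeTheaters

namespace StableCurveTemperedData

namespace OfSpecialFibre

open _root_.Topology
open scoped Pointwise
open Literature.AnabelianGeometry.SemiGraphs Literature.AnabelianGeometry.SemiGraphs.ProfiniteSemiGraph

variable {p : ℕ} [Fact p.Prime] (X : TemperedCurve p) (d : X.GroupLevelData)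
  (T : SpecialFibreTower X.DeltaTemp)
  (Sigma SigmaHat : Set ℕ) (hsub : Sigma ⊆ SigmaHat) (hne : Sigma.Nonempty)
  (hprime : ∀ q ∈ SigmaHat, q.Prime)
  (S : SpecialFibreData (X.toTemperedArithmeticGroup d)) (h36 : S.Gc.Prop36Hypotheses)
  (hp : p ∉ Sigma) (TpH : Subgroup S.chart.G)
  (HatH : Subgroup (TemperedGraphGroupData.exists_completion_of_prop36 S.Gc h36 S.chart).choose)
  (hle : TpH.map (TemperedGraphGroupData.exists_completion_of_prop36 S.Gc h36
    S.chart).choose_spec.choose.toMonoidHom ≤ HatH)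
  (cuspMeetsH : {x : X.Pt // X.IsCusp x} → Prop)

/-- **[IUTchI] Prop. 2.4 (iii) AS TYPED at the genuine 𝔛-datum carrying `P`** (FACT-LIST F-2601 instance form), from the
Prop. 2.4 (i) inputs `hstf` · `hA3` · `hspec` · `hadm` + verticial/node DATA, and a cusp `x` of `X` (abc-iut-L5-t11's
`prop24iii_ofSpecialFibre`: (iii) ⇐ (i) + the pro-`Σ` Sylow atom supplied by `I_x ≅ Ẑ(1)`, p. 51 l. 14–20).
([IUTchI] Prop 2.4(iii) p.51) [claim: Mochizuki2012, status: disputed] -/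
theorem prop24iii_ofPiData_of_admKer_nhds_one (P : SpecialFibreTower.PiData X d S T)
    (x : {x : X.Pt // X.IsCusp x})
    (hstf : (ofSpecialFibre X d S h36 Sigma SigmaHat hsub hne hprime hp TpH HatH hle cuspMeetsH).StronglyTorsionFreeSigma)
    (Λv : ∀ i, (T.Gc i).graph.Vertex → Subgroup (T.chart i).G)
    (hΛv : ∀ i v, Λv i v ∈ verticialSubgroups (T.chart i) v)
    (E : ℕ → Type) (src tgt : ∀ i, E i → (T.Gc i).graph.Vertex) (c₁ c₂ : ∀ i, E i → (T.chart i).G)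
    (hA3 : ∀ i (v w : (T.Gc i).graph.Vertex) (g h : (levelGraph X T Sigma SigmaHat hsub hne hprime i).Hat),
      MulAut.conj g • (Λv i v).map (levelGraph X T Sigma SigmaHat hsub hne hprime i).ι ⊓
          MulAut.conj h • (Λv i w).map (levelGraph X T Sigma SigmaHat hsub hne hprime i).ι ≠ ⊥ →
        (v = w ∧ g⁻¹ * h ∈ (Λv i v).map (levelGraph X T Sigma SigmaHat hsub hne hprime i).ι) ∨
        ∃ (e : E i) (k : (levelGraph X T Sigma SigmaHat hsub hne hprime i).Hat),
          ∃ p ∈ (Λv i (src i e)).map (levelGraph X T Sigma SigmaHat hsub hne hprime i).ι,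
          ∃ q ∈ (Λv i (tgt i e)).map (levelGraph X T Sigma SigmaHat hsub hne hprime i).ι,
            (src i e = v ∧ tgt i e = w ∧
                g = k * (levelGraph X T Sigma SigmaHat hsub hne hprime i).ι (c₁ i e) * p ∧
                h = k * (levelGraph X T Sigma SigmaHat hsub hne hprime i).ι (c₂ i e) * q) ∨
            (src i e = w ∧ tgt i e = v ∧
                h = k * (levelGraph X T Sigma SigmaHat hsub hne hprime i).ι (c₁ i e) * p ∧
                g = k * (levelGraph X T Sigma SigmaHat hsub hne hprime i).ι (c₂ i e) * q))
    (hspec : (towerOfSpecialFibreTower X d T Sigma SigmaHat hsub hne hprime S h36 hp TpH HatH hle cuspMeetsH).SpecializationAb)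
    (hadm : ∀ U ∈ 𝓝 (1 : ↥X.DeltaTemp), ∃ j, ((T.admKer j : Subgroup ↥X.DeltaTemp) : Set ↥X.DeltaTemp) ⊆ U) :
    (ofSpecialFibre X d S h36 Sigma SigmaHat hsub hne hprime hp TpH HatH hle cuspMeetsH).Prop24iii :=
  prop24iii_ofSpecialFibre X d S h36 Sigma SigmaHat hsub hne hprime hp TpH HatH hle cuspMeetsH x
    (prop24i_ofPiData_of_admKer_nhds_one X d T Sigma SigmaHat hsub hne hprime S h36 hp TpH HatH hle cuspMeetsH P hstf
      Λv hΛv E src tgt c₁ c₂ hA3 hspec hadm)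

/-- **[IUTchI] Prop. 2.4 (i) ∧ (ii) ∧ (iii) AS TYPED at the genuine 𝔛-datum carrying `P`** (FACT-LIST F-2599 · F-2600 ·
F-2601 instance forms at once), from the laws `hstf` · `hA3` · `hspec` · `hadm` · `hLev`, verticial/node DATA and a cusp `x`.
([IUTchI] Prop 2.4 pp.50-51) [claim: Mochizuki2012, status: disputed] -/
theorem prop24_ofPiData_of_admKer_nhds_one (P : SpecialFibreTower.PiData X d S T)
    (x : {x : X.Pt // X.IsCusp x})
    (hstf : (ofSpecialFibre X d S h36 Sigma SigmaHat hsub hne hprime hp TpH HatH hle cuspMeetsH).StronglyTorsionFreeSigma)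
    (Λv : ∀ i, (T.Gc i).graph.Vertex → Subgroup (T.chart i).G)
    (hΛv : ∀ i v, Λv i v ∈ verticialSubgroups (T.chart i) v)
    (E : ℕ → Type) (src tgt : ∀ i, E i → (T.Gc i).graph.Vertex) (c₁ c₂ : ∀ i, E i → (T.chart i).G)
    (hA3 : ∀ i (v w : (T.Gc i).graph.Vertex) (g h : (levelGraph X T Sigma SigmaHat hsub hne hprime i).Hat),
      MulAut.conj g • (Λv i v).map (levelGraph X T Sigma SigmaHat hsub hne hprime i).ι ⊓
          MulAut.conj h • (Λv i w).map (levelGraph X T Sigma SigmaHat hsub hne hprime i).ι ≠ ⊥ →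
        (v = w ∧ g⁻¹ * h ∈ (Λv i v).map (levelGraph X T Sigma SigmaHat hsub hne hprime i).ι) ∨
        ∃ (e : E i) (k : (levelGraph X T Sigma SigmaHat hsub hne hprime i).Hat),
          ∃ p ∈ (Λv i (src i e)).map (levelGraph X T Sigma SigmaHat hsub hne hprime i).ι,
          ∃ q ∈ (Λv i (tgt i e)).map (levelGraph X T Sigma SigmaHat hsub hne hprime i).ι,
            (src i e = v ∧ tgt i e = w ∧
                g = k * (levelGraph X T Sigma SigmaHat hsub hne hprime i).ι (c₁ i e) * p ∧
                h = k * (levelGraph X T Sigma SigmaHat hsub hne hprime i).ι (c₂ i e) * q) ∨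
            (src i e = w ∧ tgt i e = v ∧
                h = k * (levelGraph X T Sigma SigmaHat hsub hne hprime i).ι (c₁ i e) * p ∧
                g = k * (levelGraph X T Sigma SigmaHat hsub hne hprime i).ι (c₂ i e) * q))
    (hspec : (towerOfSpecialFibreTower X d T Sigma SigmaHat hsub hne hprime S h36 hp TpH HatH hle cuspMeetsH).SpecializationAb)
    (hadm : ∀ U ∈ 𝓝 (1 : ↥X.DeltaTemp), ∃ j, ((T.admKer j : Subgroup ↥X.DeltaTemp) : Set ↥X.DeltaTemp) ⊆ U)
    (hLev : (qTowerOfSpecialFibreTower X T d S h36 Sigma SigmaHat hsub hne hprime hp TpH HatH hle cuspMeetsH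
      P.admKer_normal_pi).LevelObservation) :
    (ofSpecialFibre X d S h36 Sigma SigmaHat hsub hne hprime hp TpH HatH hle cuspMeetsH).Prop24i ∧
      (ofSpecialFibre X d S h36 Sigma SigmaHat hsub hne hprime hp TpH HatH hle cuspMeetsH).Prop24ii ∧
      (ofSpecialFibre X d S h36 Sigma SigmaHat hsub hne hprime hp TpH HatH hle cuspMeetsH).Prop24iii := by
  obtain ⟨h24i, h24ii⟩ := prop24i_prop24ii_ofPiData_of_admKer_nhds_one X d T Sigma SigmaHat hsub hne hprime S h36 hp
    TpH HatH hle cuspMeetsH P hstf Λv hΛv E src tgt c₁ c₂ hA3 hspec hadm hLev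
  exact ⟨h24i, h24ii,
    prop24iii_ofSpecialFibre X d S h36 Sigma SigmaHat hsub hne hprime hp TpH HatH hle cuspMeetsH x h24i⟩

/-- **[IUTchI] Prop. 2.4 (i)(ii)(iii) ∧ Cor. 2.5 (both clauses) AS TYPED at the genuine 𝔛-datum carrying `P`** — the
Prop. 2.4 / Cor. 2.5 sub-block of the [IUTchI] §2 held rows (CERT-L5 v0.6 (β), p442476) with `hINV` gone: laws `hstf` ·
`hA3` · `hspec` · `hadm` · `hLev`, verticial/node DATA, a cusp `x` ("`X` has a closed point and a cusp"); Cor. 2.5 by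
abc-iut-L5-t11's `cor25_ofSpecialFibre` (every other printed input of Cor. 2.5 is a theorem of the [SemiAnbd] §6
interface and its parameter bundle). ([IUTchI] Prop 2.4, Cor 2.5 pp.50-51) [claim: Mochizuki2012, status: disputed] -/
theorem prop24_cor25_ofPiData_of_admKer_nhds_one (P : SpecialFibreTower.PiData X d S T)
    (x : {x : X.Pt // X.IsCusp x})
    (hstf : (ofSpecialFibre X d S h36 Sigma SigmaHat hsub hne hprime hp TpH HatH hle cuspMeetsH).StronglyTorsionFreeSigma)
    (Λv : ∀ i, (T.Gc i).graph.Vertex → Subgroup (T.chart i).G)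
    (hΛv : ∀ i v, Λv i v ∈ verticialSubgroups (T.chart i) v)
    (E : ℕ → Type) (src tgt : ∀ i, E i → (T.Gc i).graph.Vertex) (c₁ c₂ : ∀ i, E i → (T.chart i).G)
    (hA3 : ∀ i (v w : (T.Gc i).graph.Vertex) (g h : (levelGraph X T Sigma SigmaHat hsub hne hprime i).Hat),
      MulAut.conj g • (Λv i v).map (levelGraph X T Sigma SigmaHat hsub hne hprime i).ι ⊓
          MulAut.conj h • (Λv i w).map (levelGraph X T Sigma SigmaHat hsub hne hprime i).ι ≠ ⊥ →
        (v = w ∧ g⁻¹ * h ∈ (Λv i v).map (levelGraph X T Sigma SigmaHat hsub hne hprime i).ι) ∨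
        ∃ (e : E i) (k : (levelGraph X T Sigma SigmaHat hsub hne hprime i).Hat),
          ∃ p ∈ (Λv i (src i e)).map (levelGraph X T Sigma SigmaHat hsub hne hprime i).ι,
          ∃ q ∈ (Λv i (tgt i e)).map (levelGraph X T Sigma SigmaHat hsub hne hprime i).ι,
            (src i e = v ∧ tgt i e = w ∧
                g = k * (levelGraph X T Sigma SigmaHat hsub hne hprime i).ι (c₁ i e) * p ∧
                h = k * (levelGraph X T Sigma SigmaHat hsub hne hprime i).ι (c₂ i e) * q) ∨
            (src i e = w ∧ tgt i e = v ∧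
                h = k * (levelGraph X T Sigma SigmaHat hsub hne hprime i).ι (c₁ i e) * p ∧
                g = k * (levelGraph X T Sigma SigmaHat hsub hne hprime i).ι (c₂ i e) * q))
    (hspec : (towerOfSpecialFibreTower X d T Sigma SigmaHat hsub hne hprime S h36 hp TpH HatH hle cuspMeetsH).SpecializationAb)
    (hadm : ∀ U ∈ 𝓝 (1 : ↥X.DeltaTemp), ∃ j, ((T.admKer j : Subgroup ↥X.DeltaTemp) : Set ↥X.DeltaTemp) ⊆ U)
    (hLev : (qTowerOfSpecialFibreTower X T d S h36 Sigma SigmaHat hsub hne hprime hp TpH HatH hle cuspMeetsH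
      P.admKer_normal_pi).LevelObservation) :
    ((ofSpecialFibre X d S h36 Sigma SigmaHat hsub hne hprime hp TpH HatH hle cuspMeetsH).Prop24i ∧
      (ofSpecialFibre X d S h36 Sigma SigmaHat hsub hne hprime hp TpH HatH hle cuspMeetsH).Prop24ii ∧
      (ofSpecialFibre X d S h36 Sigma SigmaHat hsub hne hprime hp TpH HatH hle cuspMeetsH).Prop24iii) ∧
    ((ofSpecialFibre X d S h36 Sigma SigmaHat hsub hne hprime hp TpH HatH hle cuspMeetsH).Cor25Decomposition ∧
      (ofSpecialFibre X d S h36 Sigma SigmaHat hsub hne hprime hp TpH HatH hle cuspMeetsH).Cor25Inertia) := by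
  haveI : Nonempty X.Pt := ⟨x.1⟩
  haveI : Nonempty {x : X.Pt // X.IsCusp x} := ⟨x⟩
  obtain ⟨h24i, h24ii, h24iii⟩ := prop24_ofPiData_of_admKer_nhds_one X d T Sigma SigmaHat hsub hne hprime S h36 hp TpH
    HatH hle cuspMeetsH P x hstf Λv hΛv E src tgt c₁ c₂ hA3 hspec hadm hLev
  exact ⟨⟨h24i, h24ii, h24iii⟩,
    cor25_ofSpecialFibre X d S h36 Sigma SigmaHat hsub hne hprime hp TpH HatH hle cuspMeetsH h24i h24ii⟩

end OfSpecialFibre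

end StableCurveTemperedData

end Literature.IUT.HodgeTheaters

end
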